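import Mathlib
import HarnessLib
import Summits.QuantumFields.YangMills.Theses.PencilRigidity
import Summits.QuantumFields.YangMills.Theorems.PencilRigidityCurvatureKernelBoundOddTorusCovCauchySchwarz
import Summits.QuantumFields.YangMills.Theorems.PencilRigidityCurvatureKernelBoundCovAxisNormalisation
import Summits.QuantumFields.YangMills.Theorems.PencilRigidityCurvatureKernelBoundAxisDominationOfForm
import Summits.QuantumFields.YangMills.Theorems.PencilRigidityCurvatureKernelBoundKernelConclusionOfWitnessLatticeDFree

/-!
# `CurvatureKernelBound` (stmt-QuantumFields-11687), line `sixteen-charts-analytic-kernel` — the axis-currency glue, importable: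
# `AxisToLatticeWindow` (axis window bound ⇒ E‴₁'s one-variable window bound, per scheme) and the existence-leg fold
# `KernelConclusionOfWitnessAxis` (W₁-datum + axis window bound ⇒ the kernel conclusion of the crux for that family)

Helper file of the lead (prover-line-stmt-QuantumFields-11687-c4-0), `--supports stmt-QuantumFields-11687`. It transplants the positive
(`β_k ≥ 0`) branch of skeleton v14's glue `latticeKernelWindowBound_of` from the workfile into the tree, so that routes and the planner can
consume the axis currency WITHOUT the skeleton: `AxisToLatticeWindow` turns the axis window bound on
`latticeConnectedCorr r.ρ (sch.β k) (2 L_k + 1) Q^θ Q m` / `… Q Q^θ m` (the object of W₁'s `HasLatticeMassGap`, renormalised by `c_k²`) into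
the one-variable window bound on `c_k² Cov_k(Q_0, Q_z)` (sup-norm coordinate `n = ‖z‖_∞`, `CovAxisNormalisation` p128179,
`AxisDominationOfForm` p128805 fed with `OddTorusCovCauchySchwarz` p127937, rpow bookkeeping `window_bound_transfer`, `a_k L_k → ∞`), and
`KernelConclusionOfWitnessAxis` composes it with `KernelConclusionOfWitnessLatticeDFree` (p126625). [OsterwalderSeiler1978 §2; folklore]
-/

noncomputable section

open scoped BigOperators Topology
open Filter Set Function TopologicalSpace MeasureTheory
open Literature.MathematicalPhysics.QuantumLattice Literature.MathematicalPhysics.AQFT Literature.MathematicalPhysics.QuantumFieldTheory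
open Literature.Probability.LatticeModels (box mem_box)

namespace Summit.QuantumFields.YangMills.Theorems.CurvatureKernel

namespace AxisGlue

/-- Every lattice site has a coordinate of maximal modulus: `z i = ±n`, `|z j| ≤ n` for all `j`. [folklore] -/
theorem exists_coord_abs_eq (z : Literature.Probability.LatticeModels.Site 4) :
    ∃ (n : ℕ) (i : Fin 4), (z i = n ∨ z i = -n) ∧ ∀ j, |z j| ≤ n := by
  obtain ⟨i, -, hi⟩ := Finset.exists_mem_eq_sup (Finset.univ : Finset (Fin 4)) Finset.univ_nonempty
    (fun j => (z j).natAbs)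
  refine ⟨(z i).natAbs, i, ?_, fun j => ?_⟩
  · rcases Int.natAbs_eq (z i) with h | h
    · exact Or.inl h
    · exact Or.inr h
  · have hj : (z j).natAbs ≤ Finset.univ.sup (fun j => (z j).natAbs) :=
      Finset.le_sup (f := fun j => (z j).natAbs) (Finset.mem_univ j)
    rw [hi] at hj
    rw [← Int.natCast_natAbs]
    exact_mod_cast hj

/-- A coordinate is bounded by the Euclidean norm of the embedded site. [folklore] -/
theorem abs_coord_le_norm_siteToE (z : Literature.Probability.LatticeModels.Site 4) (i : Fin 4) :
    |(z i : ℝ)| ≤ ‖siteToE z‖ := by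
  have h := PiLp.norm_apply_le (siteToE z) i
  rwa [siteToE_apply, Real.norm_eq_abs] at h

/-- The Euclidean norm of the embedded site is at most twice its sup norm (dimension four). [folklore] -/
theorem norm_siteToE_le_two_mul (z : Literature.Probability.LatticeModels.Site 4) {n : ℕ} (h : ∀ j, |z j| ≤ n) :
    ‖siteToE z‖ ≤ 2 * n := by
  rw [EuclideanSpace.norm_eq]
  have hs : ∑ j, ‖siteToE z j‖ ^ 2 ≤ ∑ _j : Fin 4, (n : ℝ) ^ 2 := Finset.sum_le_sum fun j _ => by
    rw [siteToE_apply, Real.norm_eq_abs]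
    have hj : |(z j : ℝ)| ≤ n := by
      have := h j
      rw [← Int.cast_abs]
      exact_mod_cast this
    exact pow_le_pow_left₀ (abs_nonneg _) hj 2
  calc Real.sqrt (∑ j, ‖siteToE z j‖ ^ 2) ≤ Real.sqrt (∑ _j : Fin 4, (n : ℝ) ^ 2) := Real.sqrt_le_sqrt hs
    _ = 2 * n := by
        rw [Finset.sum_const, Finset.card_univ, Fintype.card_fin, nsmul_eq_mul]
        rw [show ((4 : ℕ) : ℝ) * (n : ℝ) ^ 2 = (2 * n) ^ 2 by push_cast; ring]
        exact Real.sqrt_sq (by positivity)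

/-- Elementary: a window bound `C (a m)^(η−10)` at a lattice separation `m` with `a m ≤ θ` and `‖z‖/4 ≤ m·a/a…` is dominated by
`K (a‖z‖)^(η'−10)` with `η' = min η 1` and `K = max C 0 · θ^(η−η') · 4^(10−η')`. [folklore] -/
theorem window_bound_transfer {C η θ a s : ℝ} {m : ℕ} (ha : 0 < a) (hm : 0 < (m : ℝ))
    (hmθ : a * m ≤ θ) (hs : 0 < s) (hsm : s ≤ 4 * m) {X : ℝ} (hX : X ≤ C * (a * m) ^ (η - 10)) :
    X ≤ (max C 0 * θ ^ (η - min η 1) * (4 : ℝ) ^ (10 - min η 1)) * (a * s) ^ (min η 1 - 10) := by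
  set η' := min η 1 with hη'
  have ham : 0 < a * m := mul_pos ha hm
  have has : 0 < a * s := mul_pos ha hs
  have hθ : 0 < θ := lt_of_lt_of_le ham hmθ
  have h1 : X ≤ max C 0 * (a * m) ^ (η - 10) :=
    hX.trans (mul_le_mul_of_nonneg_right (le_max_left _ _) (Real.rpow_nonneg ham.le _))
  have hsplit : (a * m) ^ (η - 10) = (a * m) ^ (η - η') * (a * m) ^ (η' - 10) := by
    rw [← Real.rpow_add ham]; congr 1; ring
  have h2 : (a * m) ^ (η - η') ≤ θ ^ (η - η') :=
    Real.rpow_le_rpow ham.le hmθ (by simp [hη'])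
  have h3 : (a * m) ^ (η' - 10) ≤ (a * s / 4) ^ (η' - 10) := by
    apply Real.rpow_le_rpow_of_nonpos (by positivity)
    · rw [div_le_iff₀ (by norm_num : (0:ℝ) < 4)]; nlinarith
    · have : η' ≤ 1 := min_le_right _ _
      linarith
  have h4 : (a * s / 4) ^ (η' - 10) = (4 : ℝ) ^ (10 - η') * (a * s) ^ (η' - 10) := by
    rw [Real.div_rpow has.le (by norm_num), div_eq_inv_mul]
    congr 1
    rw [← Real.rpow_neg (by norm_num)]
    congr 1; ring
  calc X ≤ max C 0 * (a * m) ^ (η - 10) := h1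
    _ = max C 0 * ((a * m) ^ (η - η') * (a * m) ^ (η' - 10)) := by rw [hsplit]
    _ ≤ max C 0 * (θ ^ (η - η') * (a * s / 4) ^ (η' - 10)) := by
        apply mul_le_mul_of_nonneg_left _ (le_max_right _ _)
        exact mul_le_mul h2 h3 (Real.rpow_nonneg ham.le _) (Real.rpow_nonneg hθ.le _)
    _ = (max C 0 * θ ^ (η - η') * (4 : ℝ) ^ (10 - η')) * (a * s) ^ (η' - 10) := by rw [h4]; ring


end AxisGlue

open AxisGlue in
/-- **`AxisToLatticeWindow`** (registered support headline of stmt-QuantumFields-11687; pure lattice, no Schwinger family): for ONE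
lattice representation `r` and scheme `sch`, the AXIS window bound (along steps with `β_k ≥ 0`: `c_k² |lCC_k(Q^θ,Q,m)|, c_k² |lCC_k(Q,Q^θ,m)|
≤ C (a_k m)^(η−10)` for `R₀ ≤ m ≤ L_k`, `a_k m ≤ θ`, frequently in `k`) implies the one-variable lattice window bound of E‴₁
(`c_k² |Cov_k(Q_0,Q_z)| ≤ C′ (a_k‖z‖)^(η′−10)` on `R₀′ ≤ ‖z‖`, `a_k‖z‖ ≤ θ′`, frequently in `k`) — by the landed hypercubic normalisation
`CovAxisNormalisation`, axis domination `AxisDominationOfForm ∘ OddTorusCovCauchySchwarz`, and rpow bookkeeping. This is the positive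
branch of skeleton v14's glue, made importable. [OsterwalderSeiler1978 §2; folklore] -/
theorem AxisToLatticeWindow : open Literature.MathematicalPhysics.QuantumLattice Literature.MathematicalPhysics.AQFT Literature.MathematicalPhysics.QuantumFieldTheory in ∀ (G : Type) [Group G] [TopologicalSpace G] [IsTopologicalGroup G] [CompactSpace G] [MeasurableSpace G] [BorelSpace G] (r : LatticeRep G) (sch : SpeciesScheme (YMSpecies G)), (∃ (C η θ R₀ : ℝ), 0 < η ∧ 0 < θ ∧ ∃ᶠ k in Filter.atTop, 0 ≤ sch.β k ∧ ∀ m : ℕ, R₀ ≤ (m : ℝ) → sch.a k * (m : ℝ) ≤ θ → m ≤ sch.L k → (sch.c r.curvature k) ^ 2 * |latticeConnectedCorr r.ρ (sch.β k) (2 * sch.L k + 1) r.curvature.timeReflect.F r.curvature.F m| ≤ C * (sch.a k * (m : ℝ)) ^ (η - 10) ∧ (sch.c r.curvature k) ^ 2 * |latticeConnectedCorr r.ρ (sch.β k) (2 * sch.L k + 1) r.curvature.F r.curvature.timeReflect.F m| ≤ C * (sch.a k * (m : ℝ)) ^ (η - 10)) → (∃ (C η θ R₀ : ℝ), 0 <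 η ∧ 0 < θ ∧ ∃ᶠ k in Filter.atTop, ∀ z : Literature.Probability.LatticeModels.Site 4, z ∈ Literature.Probability.LatticeModels.box 4 (sch.L k) → z ≠ 0 → R₀ ≤ ‖siteToE z‖ → sch.a k * ‖siteToE z‖ ≤ θ → (sch.c r.curvature k) ^ 2 * |(∫ U, r.curvature.F (torusLift (sch.side k) U) * r.curvature.F (configShift (-z) (torusLift (sch.side k) U)) ∂(wilsonMeasure r.ρ (sch.β k) : MeasureTheory.Measure (GaugeConfig 4 (sch.side k) G))) - (∫ U, r.curvature.F (torusLift (sch.side k) U) ∂(wilsonMeasure r.ρ (sch.β k) : MeasureTheory.Measure (GaugeConfig 4 (sch.side k) G))) * (∫ U, r.curvature.F (configShift (-z) (torusLift (sch.side k) U)) ∂(wilsonMeasure r.ρ (sch.β k) : MeasureTheory.Measure (GaugeConfig 4 (sch.side k) G)))| ≤ C * (sch.a k * ‖siteToE z‖) ^ (η - 10)) := by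
  intro G _ _ _ _ _ _ r sch hAX
  obtain ⟨C, η, θ, R₀, hη, hθ, hfreq⟩ := hAX
  have hP := Summit.QuantumFields.YangMills.Theorems.CurvatureKernel.CovAxisNormalisation
  have hA := Summit.QuantumFields.YangMills.Theorems.CurvatureKernel.AxisDominationOfForm Summit.QuantumFields.YangMills.Theorems.CurvatureKernel.OddTorusCovCauchySchwarz
  set K : ℝ := max C 0 * θ ^ (η - min η 1) * (4 : ℝ) ^ (10 - min η 1) with hK
  refine ⟨2 * K, min η 1, θ / 2, 2 * max R₀ 0 + 6, lt_min hη one_pos, half_pos hθ, ?_⟩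
  have hev : ∀ᶠ k in Filter.atTop, θ < sch.a k * sch.L k := sch.tendsto_L.eventually_gt_atTop θ
  refine (hfreq.and_eventually hev).mono ?_
  rintro k ⟨⟨hβk, hbd⟩, hkL⟩ z hz hz0 hR hθz
  have ha : 0 < sch.a k := sch.a_pos k
  -- the sup-norm coordinate
  obtain ⟨n, i, hi, hle⟩ := exists_coord_abs_eq z
  have hn_le : (n : ℝ) ≤ ‖siteToE z‖ := by
    have h := abs_coord_le_norm_siteToE z i
    rcases hi with h' | h' <;> rw [h'] at h <;> simpa using h
  have hle2 : ‖siteToE z‖ ≤ 2 * n := norm_siteToE_le_two_mul z hle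
  have hR0 : 0 ≤ max R₀ 0 := le_max_right _ _
  have hn3r : max R₀ 0 + 3 ≤ (n : ℝ) := by linarith
  have hn3 : 3 ≤ n := by exact_mod_cast (show ((3 : ℕ) : ℝ) ≤ n by push_cast; linarith)
  have hnpos : 0 < (n : ℝ) := by exact_mod_cast (show 0 < n by omega)
  have hnL : n ≤ sch.L k := by
    have hzi := (mem_box.1 hz) i
    rcases hi with h' | h' <;> rw [h'] at hzi <;> omega
  -- normalise to the time axis and dominate
  obtain ⟨z', hz'0, hcov⟩ := hP G r (sch.β k) (sch.L k) z i n hi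
  obtain ⟨hD1, hD2, hCS⟩ := hA G r (sch.β k) hβk (sch.L k) z' n hz'0 hn3 hnL
  -- the two axis separations
  have hm_ge : ∀ m : ℕ, n ≤ m + 1 → m ≤ n + 1 → R₀ ≤ (m : ℝ) ∧ sch.a k * (m : ℝ) ≤ θ ∧ m ≤ sch.L k ∧ 0 < (m : ℝ) ∧
      ‖siteToE z‖ ≤ 4 * m := by
    intro m hm1 hm2
    have hm1r : (n : ℝ) ≤ m + 1 := by exact_mod_cast hm1
    have hm2r : (m : ℝ) ≤ n + 1 := by exact_mod_cast hm2
    have hmθ : sch.a k * (m : ℝ) ≤ θ := by nlinarith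
    refine ⟨by linarith [le_max_left R₀ 0], hmθ, ?_, by linarith, by linarith⟩
    have : (m : ℝ) < sch.L k := by
      by_contra hcon
      push Not at hcon
      have : sch.a k * sch.L k ≤ sch.a k * m := mul_le_mul_of_nonneg_left hcon ha.le
      linarith
    exact_mod_cast this.le
  obtain ⟨hR1, hθ1, hL1, hpos1, hs1⟩ := hm_ge (2 * (n / 2)) (by omega) (by omega)
  obtain ⟨hR2, hθ2, hL2, hpos2, hs2⟩ := hm_ge (2 * ((n + 1) / 2)) (by omega) (by omega)
  obtain ⟨hB1, -⟩ := hbd (2 * (n / 2)) hR1 hθ1 hL1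
  obtain ⟨-, hB2⟩ := hbd (2 * ((n + 1) / 2)) hR2 hθ2 hL2
  have hnormpos : 0 < ‖siteToE z‖ := by
    have : siteToE z ≠ 0 := fun h => hz0 ((LatticeWindow.siteToE_eq_zero_iff z).1 h)
    exact norm_pos_iff.2 this
  rw [abs_of_nonneg hD1] at hB1
  rw [abs_of_nonneg hD2] at hB2
  have hT1 := window_bound_transfer (C := C) (η := η) ha hpos1 hθ1 hnormpos hs1 hB1
  have hT2 := window_bound_transfer (C := C) (η := η) ha hpos2 hθ2 hnormpos hs2 hB2
  rw [← hK] at hT1 hT2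
  set c2 : ℝ := (sch.c r.curvature k) ^ 2 with hc2
  have hc2nn : 0 ≤ c2 := sq_nonneg _
  have hKs : 0 ≤ K * (sch.a k * ‖siteToE z‖) ^ (min η 1 - 10) := by
    have : 0 ≤ K := by rw [hK]; positivity
    exact mul_nonneg this (Real.rpow_nonneg (mul_nonneg ha.le (norm_nonneg _)) _)
  have key : c2 * |((∫ U, r.curvature.F (torusLift (2 * sch.L k + 1) U) * r.curvature.F (configShift (-z) (torusLift (2 * sch.L k + 1) U)) ∂(wilsonMeasure r.ρ (sch.β k) : MeasureTheory.Measure (GaugeConfig 4 (2 * sch.L k + 1) G))) - (∫ U, r.curvature.F (torusLift (2 * sch.L k + 1) U) ∂(wilsonMeasure r.ρ (sch.β k) : MeasureTheory.Measure (GaugeConfig 4 (2 * sch.L k + 1) G))) * (∫ U, r.curvature.F (configShift (-z) (torusLift (2 * sch.L k + 1) U)) ∂(wilsonMeasure r.ρ (sch.β k) : MeasureTheory.Measure (GaugeConfig 4 (2 * sch.L k + 1) G))))| ≤ 2 * K * (sch.a k * ‖siteToE z‖) ^ (min η 1 - 10) := by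
    rw [hcov]
    set X := ((∫ U, r.curvature.F (torusLift (2 * sch.L k + 1) U) * r.curvature.F (configShift (-z') (torusLift (2 * sch.L k + 1) U)) ∂(wilsonMeasure r.ρ (sch.β k) : MeasureTheory.Measure (GaugeConfig 4 (2 * sch.L k + 1) G))) - (∫ U, r.curvature.F (torusLift (2 * sch.L k + 1) U) ∂(wilsonMeasure r.ρ (sch.β k) : MeasureTheory.Measure (GaugeConfig 4 (2 * sch.L k + 1) G))) * (∫ U, r.curvature.F (configShift (-z') (torusLift (2 * sch.L k + 1) U)) ∂(wilsonMeasure r.ρ (sch.β k) : MeasureTheory.Measure (GaugeConfig 4 (2 * sch.L k + 1) G)))) with hX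
    have hsq : (c2 * |X|) ^ 2 ≤ (K * (sch.a k * ‖siteToE z‖) ^ (min η 1 - 10)) ^ 2 := by
      calc (c2 * |X|) ^ 2 = c2 * c2 * X ^ 2 := by rw [mul_pow, sq_abs]; ring
        _ ≤ c2 * c2 * (latticeConnectedCorr r.ρ (sch.β k) (2 * sch.L k + 1) r.curvature.F r.curvature.timeReflect.F (2 * ((n + 1) / 2)) * latticeConnectedCorr r.ρ (sch.β k) (2 * sch.L k + 1) r.curvature.timeReflect.F r.curvature.F (2 * (n / 2))) :=
            mul_le_mul_of_nonneg_left hCS (mul_nonneg hc2nn hc2nn)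
        _ = (c2 * latticeConnectedCorr r.ρ (sch.β k) (2 * sch.L k + 1) r.curvature.timeReflect.F r.curvature.F (2 * (n / 2))) * (c2 * latticeConnectedCorr r.ρ (sch.β k) (2 * sch.L k + 1) r.curvature.F r.curvature.timeReflect.F (2 * ((n + 1) / 2))) := by ring
        _ ≤ (K * (sch.a k * ‖siteToE z‖) ^ (min η 1 - 10)) * (K * (sch.a k * ‖siteToE z‖) ^ (min η 1 - 10)) :=
            mul_le_mul hT1 hT2 (mul_nonneg hc2nn hD2) hKs
        _ = (K * (sch.a k * ‖siteToE z‖) ^ (min η 1 - 10)) ^ 2 := by ring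
    have hfin : c2 * |X| ≤ K * (sch.a k * ‖siteToE z‖) ^ (min η 1 - 10) :=
      (pow_le_pow_iff_left₀ (mul_nonneg hc2nn (abs_nonneg _)) hKs two_ne_zero).1 hsq
    linarith
  exact key

/-- **`KernelConclusionOfWitnessAxis`** (registered support headline of stmt-QuantumFields-11687; the existence-leg fold in AXIS currency):
for ONE datum `(r, sch, S₁)` carrying the curvature package W₁, the axis window bound of its scheme (along steps with `β_k ≥ 0`) already yields
the conclusion of `CurvatureKernelBound` for `S₁` — a REAL kernel, continuous off `0`, below `|x|⁻¹⁰`, representing `S₁ 2` on `⁰𝒮` — by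
`AxisToLatticeWindow` and the landed D-free per-witness theorem `KernelConclusionOfWitnessLatticeDFree` (p126625). A planner folding the UV
datum into the existence leg `WeakCouplingHypercubicLimit` (which has `β_k → +∞`) reads the kernel conclusion off this theorem. [OsterwalderSeiler1978 §2; folklore] -/
theorem KernelConclusionOfWitnessAxis : open Literature.MathematicalPhysics.QuantumLattice Literature.MathematicalPhysics.AQFT Literature.MathematicalPhysics.QuantumFieldTheory in ∀ (G : Type) [Group G] [TopologicalSpace G] [IsTopologicalGroup G] [CompactSpace G] [MeasurableSpace G] [BorelSpace G], IsCompactSimpleLieGroup G → ∀ (r : LatticeRep G) (sch : SpeciesScheme (YMSpecies G)) (S₁ : SchwingerFamily (EuclideanSpace ℝ (Fin 4))), ((∀ (n : ℕ), n ≠ 0 → ∀ (f : Fin n → SchwartzMap (EuclideanSpace ℝ (Fin 4)) ℝ) (F : SchwartzMap (Fin n → (EuclideanSpace ℝ (Fin 4))) ℂ), IsTensorOf F (fun i => ofRealTest (f i)) → IsOffDiagonal F → Filter.Tendsto (fun k : ℕ => ((latticeSchwinger r.ρ sch (fun s => s.F) k n (fun _ => r.curvature) f : ℝ) : ℂ))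 Filter.atTop (nhds (S₁ n F))) ∧ (S₁.toLabelled.IsNormalized ∧ S₁.toLabelled.IsHermitian ∧ S₁.toLabelled.HasLinearGrowth ∧ S₁.toLabelled.IsReflectionPositive ∧ S₁.toLabelled.IsSymmetric ∧ S₁.toLabelled.HasClusterProperty) ∧ (∀ (n : ℕ) (a : (EuclideanSpace ℝ (Fin 4))) (F : SchwartzMap (Fin n → (EuclideanSpace ℝ (Fin 4))) ℂ), IsOffDiagonal F → S₁ n (translateMulti a F) = S₁ n F) ∧ (∀ (R : (EuclideanSpace ℝ (Fin 4)) ≃ₗᵢ[ℝ] (EuclideanSpace ℝ (Fin 4))), LinearMap.det (R.toLinearEquiv : (EuclideanSpace ℝ (Fin 4)) →ₗ[ℝ] (EuclideanSpace ℝ (Fin 4))) = 1 → (∀ i : Fin 4, ∃ j : Fin 4, R (EuclideanSpace.single i 1) = EuclideanSpace.single j 1 ∨ R (EuclideanSpace.single i 1) = -EuclideanSpace.single j 1) → ∀ (n : ℕ) (F : SchwartzMap (Fin n → (EuclideanSpace ℝ (Fin 4))) ℂ), IsOffDiagonal F → S₁ n (linActMulti R F) = S₁ n F) ∧ (∃ Δ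 : ℝ, 0 < Δ ∧ S₁.toLabelled.HasMassGap Δ ∧ HasLatticeMassGap r sch Δ)) → (∃ (C η θ R₀ : ℝ), 0 < η ∧ 0 < θ ∧ ∃ᶠ k in Filter.atTop, 0 ≤ sch.β k ∧ ∀ m : ℕ, R₀ ≤ (m : ℝ) → sch.a k * (m : ℝ) ≤ θ → m ≤ sch.L k → (sch.c r.curvature k) ^ 2 * |latticeConnectedCorr r.ρ (sch.β k) (2 * sch.L k + 1) r.curvature.timeReflect.F r.curvature.F m| ≤ C * (sch.a k * (m : ℝ)) ^ (η - 10) ∧ (sch.c r.curvature k) ^ 2 * |latticeConnectedCorr r.ρ (sch.β k) (2 * sch.L k + 1) r.curvature.F r.curvature.timeReflect.F m| ≤ C * (sch.a k * (m : ℝ)) ^ (η - 10)) → ∃ (K : (EuclideanSpace ℝ (Fin 4)) → ℝ) (C η : ℝ), 0 < η ∧ ContinuousOn K {x : (EuclideanSpace ℝ (Fin 4)) | x ≠ 0} ∧ (∀ x : (EuclideanSpace ℝ (Fin 4)), x ≠ 0 → |K x| ≤ C * (1 + ‖x‖ ^ (η - 10))) ∧ ∀ F : SchwartzMap (Fin 2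 → (EuclideanSpace ℝ (Fin 4))) ℂ, IsOffDiagonal F → MeasureTheory.Integrable (fun x : Fin 2 → (EuclideanSpace ℝ (Fin 4)) => (K (x 0 - x 1) : ℂ) * F x) ∧ S₁ 2 F = ∫ x : Fin 2 → (EuclideanSpace ℝ (Fin 4)), (K (x 0 - x 1) : ℂ) * F x := by
  intro G _ _ _ _ _ _ hG r sch S₁ hW₁ hAX
  exact Summit.QuantumFields.YangMills.Theorems.CurvatureKernel.KernelConclusionOfWitnessLatticeDFree G hG r sch S₁ hW₁ (AxisToLatticeWindow G r sch hAX)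

end Summit.QuantumFields.YangMills.Theorems.CurvatureKernel

end
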